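import Summits.MatrixMultiplication.OmegaCensus.TriangleTorusShearedLadder
import Summits.MatrixMultiplication.OmegaCensus.TriangleTorusImbalance

/-!
# Triangle factors of a punctured sheared torus: the imbalance bound `3·|#up − #down| ≤ 4n + 2` (kernel)

ω-census `pub-omega`, family (b3), seat pub-omega-group gen 34.  Framing: lottery ticket; floor = certified bounds/negative
ranges.  VALUE: KERNEL generalisation of the cell's Theorem B (`TriangleFactor.three_mul_abs_sub_le`, square torus) to the
sheared tori of `TriangleTorusShearedLadder.ShearedFactor n a s`:
**in every partition of `(ℤ² / ⟨(a,s), (0,n)⟩) ∖ {one point}` (`3 ∤ n`, `1 ≤ a`) into translates of the triangles `{0,e₁,e₂}` and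
`{0,−e₁,−e₂}`, `3·|#up − #down| ≤ 4n + 2`** (`ShearedFactor.three_mul_abs_sub_le`), where `n` is the VERTICAL period only — the
second period `(a, s)` is arbitrary.  NOT progress on ω; the corollary for cube symmetric forms over arbitrary finite abelian
groups is drawn in `ThreeSetNoPartThreeGeneral.lean`.

Proof = the proof of `TriangleTorusImbalance` with two changes: (i) column quasi-periodicity `Qz (c + a) = Qz c` now comes from
the shear `slot (c + a) (k + 2s) = ρ^{a−s} · slot c k` followed by the WINDOW LEMMA (the window start moves by `−2s`); (ii) the
hole of the hole column sits at an arbitrary height `j₀`, so the ladder period is read from the window `[j₀, j₀ + n)` (the charge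
of a full period does not depend on the window, `kc_any`).  The algebraic layer (`Q`, `dfun`, defect bounds) is imported.
-/

namespace Summit.MatrixMultiplication.OmegaCensus.TriangleTorus

open Finset

/-- The rotation index of the shear `(c, j) ↦ (c + a, j + s)`: steps rotate by `ρ^{a − s}`. [folklore] -/
def shearRot (a : ℕ) (s : ℤ) : ZMod 3 := ((a : ℤ) : ZMod 3) + ((-s : ℤ) : ZMod 3)

/-- [folklore] -/
theorem sH_shear (a : ℕ) (s c j : ℤ) : sH (c + a) (j + s) = rot (shearRot a s) (sH c j) := by
  rw [sH_add_left, sH_add_right, ← rot_add]; rfl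

/-- [folklore] -/
theorem sV_shear (a : ℕ) (s c j : ℤ) : sV (c + a) (j + s) = rot (shearRot a s) (sV c j) := by
  rw [sV_add_left, sV_add_right, ← rot_add]; rfl

/-- [folklore] -/
theorem sD_shear (a : ℕ) (s c j : ℤ) : sD (c + a) (j + s) = rot (shearRot a s) (sD c j) := by
  rw [sD_add_left, sD_add_right, ← rot_add]; rfl

namespace ShearedFactor

open TriangleFactor (trot trot_ne_zero)

variable {n a : ℕ} {s : ℤ}

/-! ## Facts about the pieces used by the torus bookkeeping -/

/-- Every in-piece has at most four steps. [folklore] -/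
theorem length_inPiece_le (T : ShearedFactor n a s) (c j : ℤ) : (T.inPiece c j).length ≤ 4 := by
  unfold inPiece fin0 fin1
  split_ifs <;> simp

/-- Every step of an in-piece lies in the six-element star. [folklore] -/
theorem mem_steps6_of_mem_inPiece (T : ShearedFactor n a s) (c j : ℤ) : ∀ x ∈ T.inPiece c j, x ∈ steps6 := by
  have H : ∀ c j, sH c j ∈ steps6 ∧ -sH c j ∈ steps6 ∧ sV c j ∈ steps6 ∧ -sV c j ∈ steps6 ∧
      sD c j ∈ steps6 ∧ -sD c j ∈ steps6 := fun c j =>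
    ⟨(sH_mem_steps6 c j).1, (sH_mem_steps6 c j).2, (sV_mem_steps6 c j).1, (sV_mem_steps6 c j).2,
      (sD_mem_steps6 c j).1, (sD_mem_steps6 c j).2⟩
  unfold inPiece fin0 fin1
  split_ifs <;> simp [H]

/-- Height periodicity of the even slots (tiles are `n`-periodic, steps rotate by `ρ^{−n}`). [folklore] -/
theorem f0_add_right (T : ShearedFactor n a s) (c j : ℤ) : T.f0 c (j + n) = (T.f0 c j).map (rot ((-(n : ℤ) : ℤ) : ZMod 3)) := by
  simp only [f0, T.up_add_right, T.dn_add_right, show j + n - 1 = (j - 1) + n by ring, sV_add_right, sD_add_right,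
    sH_add_right]
  split_ifs <;> simp [rot_neg_vec]

/-- Height periodicity of the odd slots. [folklore] -/
theorem f1_add_right (T : ShearedFactor n a s) (c j : ℤ) : T.f1 c (j + n) = (T.f1 c j).map (rot ((-(n : ℤ) : ℤ) : ZMod 3)) := by
  simp only [f1, T.up_add_right, show j + n + 1 = (j + 1) + n by ring, T.dn_add_right, sV_add_right, sD_add_right,
    sH_add_right]
  split_ifs <;> simp [rot_neg_vec]

/-- Shear invariance of the even slots (steps rotate by `ρ^{a−s}`). [folklore] -/
theorem f0_shear (T : ShearedFactor n a s) (c j : ℤ) : T.f0 (c + a) (j + s) = (T.f0 c j).map (rot (shearRot a s)) := by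
  simp only [f0, T.up_add_left, show c + (a : ℤ) + 1 = (c + 1) + a by ring, show c + (a : ℤ) - 1 = (c - 1) + a by ring,
    show j + s - 1 = (j - 1) + s by ring, T.dn_add_left, sV_shear, sD_shear, sH_shear]
  split_ifs <;> simp [rot_neg_vec]

/-- Shear invariance of the odd slots. [folklore] -/
theorem f1_shear (T : ShearedFactor n a s) (c j : ℤ) : T.f1 (c + a) (j + s) = (T.f1 c j).map (rot (shearRot a s)) := by
  simp only [f1, T.up_add_left, show c + (a : ℤ) + 1 = (c + 1) + a by ring, show c + (a : ℤ) - 1 = (c - 1) + a by ring,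
    show j + s + 1 = (j + 1) + s by ring, T.dn_add_left, sV_shear, sD_shear, sH_shear]
  split_ifs <;> simp [rot_neg_vec]

/-- The slot sequence of `Ẑ_c` is `2n`-periodic up to the rotation `ρ^{−n}`. [folklore] -/
theorem slot_add_period (T : ShearedFactor n a s) (c k : ℤ) : T.slot c (k + 2 * n) = (T.slot c k).map (rot ((-(n : ℤ) : ℤ) : ZMod 3)) := by
  unfold slot
  have h1 : (k + 2 * n) % 2 = k % 2 := by omega
  have h2 : (k + 2 * n) / 2 = k / 2 + n := by omega
  rw [h1, h2]
  split_ifs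
  · exact T.f0_add_right c (k / 2)
  · exact T.f1_add_right c (k / 2)

/-- The slot sequence of `Ẑ_{c+a}` is that of `Ẑ_c`, shifted by `2s` slots and rotated by `ρ^{a−s}`. [folklore] -/
theorem slot_shear (T : ShearedFactor n a s) (c k : ℤ) : T.slot (c + a) (k + 2 * s) = (T.slot c k).map (rot (shearRot a s)) := by
  unfold slot
  have h1 : (k + 2 * s) % 2 = k % 2 := by omega
  have h2 : (k + 2 * s) / 2 = k / 2 + s := by omega
  rw [h1, h2]
  split_ifs
  · exact T.f0_shear c (k / 2)
  · exact T.f1_shear c (k / 2)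

/-- The charge is `n`-periodic in the height. [folklore] -/
theorem charge_add_right (T : ShearedFactor n a s) (c j : ℤ) : T.charge c (j + n) = T.charge c j := by
  simp only [charge, T.up_add_right, T.dn_add_right]

/-- A window of `n` consecutive charges does not depend on its start (one step). [folklore] -/
theorem kc_shift (T : ShearedFactor n a s) (c lo : ℤ) : T.kc c (lo + 1) n = T.kc c lo n := by
  have h := T.kc_succ' c lo n
  rw [show T.kc c lo (n + 1) = T.kc c lo n + T.charge c (lo + (n : ℕ)) from rfl] at h
  have : T.charge c (lo + (n : ℕ)) = T.charge c lo := by exact_mod_cast T.charge_add_right c lo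
  linarith

/-- Block boundaries are `n`-periodic. [folklore] -/
theorem bdry_add_right (T : ShearedFactor n a s) (c k : ℤ) : T.bdry c (k + n) ↔ T.bdry c k := by
  simp only [bdry, show k + n - 1 = (k - 1) + n by ring, T.up_add_right, T.dn_add_right]

/-- Every column has a block boundary below cell `0` or below cell `1`. [folklore] -/
theorem bdry_zero_or_one (T : ShearedFactor n a s) (c : ℤ) : T.bdry c 0 ∨ T.bdry c 1 := by
  obtain ⟨-, -, -, h3, h4, -, -, -⟩ := six_cases (T.cover c 0)
  by_cases hu : T.up c (0 - 1) = true
  · obtain ⟨h0, -, -, -, h5⟩ := h3 hu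
    exact Or.inr ⟨by simpa using h0, by simpa using h5⟩
  by_cases hd : T.dn c 0 = true
  · obtain ⟨h0, -, -, -, h5⟩ := h4 hd
    exact Or.inr ⟨by simpa using h0, by simpa using h5⟩
  exact Or.inl ⟨by simpa using hu, by simpa using hd⟩

/-- The invariant of the strip between columns `c` and `c+1`: the three-period functional of one period of `Ẑ_c`.
[folklore] -/
def Qz (T : ShearedFactor n a s) (c : ℤ) : ℤ := Q (trot n) (hol (lconcat (T.slot c) 0 (2 * n)))

/-- [folklore] -/
theorem OutL_eq_slots (T : ShearedFactor n a s) (c lo : ℤ) (m : ℕ) : T.OutL c lo m = lconcat (T.slot c) (2 * lo + (-1)) (2 * m) :=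
  lconcat_pairs (T.slot c) (T.outPiece c) (-1) (fun j => T.outPiece_eq_slots c j) lo m

/-- [folklore] -/
theorem InL_eq_slots (T : ShearedFactor n a s) (c lo : ℤ) (m : ℕ) : T.InL c lo m = lconcat (T.slot (c - 1)) (2 * lo + 0) (2 * m) :=
  lconcat_pairs (T.slot (c - 1)) (T.inPiece c) 0 (fun j => T.inPiece_eq_slots c j) lo m

/-- [folklore] -/
theorem slot_add_period' (T : ShearedFactor n a s) (c k : ℤ) : T.slot c (k + ((2 * n : ℕ) : ℤ)) = (T.slot c k).map (rot (trot n)) := by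
  rw [trot, ← T.slot_add_period c k]; push_cast; ring_nf

/-- The OUT-run of any period of column `c` computes `Qz c`. [folklore] -/
theorem Q_OutL (T : ShearedFactor n a s) (h3 : ¬ 3 ∣ n) (c lo : ℤ) : Q (trot n) (hol (T.OutL c lo n)) = T.Qz c := by
  rw [OutL_eq_slots, Qz]
  exact Q_window _ (trot_ne_zero h3) _ (2 * n) (T.slot_add_period' c) _ _

/-- The IN-run of any period of column `c` computes `Qz (c − 1)`. [folklore] -/
theorem Q_InL (T : ShearedFactor n a s) (h3 : ¬ 3 ∣ n) (c lo : ℤ) : Q (trot n) (hol (T.InL c lo n)) = T.Qz (c - 1) := by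
  rw [InL_eq_slots, Qz]
  exact Q_window _ (trot_ne_zero h3) _ (2 * n) (T.slot_add_period' (c - 1)) _ _

/-- **Shear invariance of the column invariant**: `Qz (c + a) = Qz c` (rotate by `ρ^{a−s}`, then move the window start by
`−2s` with the window lemma). [folklore] -/
theorem Qz_add_left (T : ShearedFactor n a s) (h3 : ¬ 3 ∣ n) (c : ℤ) : T.Qz (c + a) = T.Qz c := by
  unfold Qz
  have e : lconcat (T.slot (c + a)) 0 (2 * n) = (lconcat (T.slot c) (-(2 * s)) (2 * n)).map (rot (shearRot a s)) := by
    rw [lconcat_map]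
    refine lconcat_congr fun i _ => ?_
    rw [show (0 : ℤ) + i = (-(2 * s) + i) + 2 * s by ring]
    exact T.slot_shear c _
  rw [e, hol_map_rot, Q_rotH]
  exact Q_window _ (trot_ne_zero h3) _ (2 * n) (T.slot_add_period' c) _ _

/-- The charge of one period of column `c`: `18·(#up-tiles − #down-tiles anchored in the column)`. [folklore] -/
def colCharge (T : ShearedFactor n a s) (c : ℤ) : ℤ := T.kc c 0 n

/-- The charge of a full period does not depend on the window. [folklore] -/
theorem kc_any (T : ShearedFactor n a s) (c lo : ℤ) : T.kc c lo n = T.colCharge c := by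
  have up : ∀ k : ℕ, T.kc c (k : ℤ) n = T.colCharge c := by
    intro k
    induction k with
    | zero => rfl
    | succ k ih => rw [← ih, show ((k + 1 : ℕ) : ℤ) = (k : ℤ) + 1 by push_cast; ring, T.kc_shift]
  have down : ∀ k : ℕ, T.kc c (-(k : ℤ)) n = T.colCharge c := by
    intro k
    induction k with
    | zero => exact up 0
    | succ k ih => rw [← ih, ← T.kc_shift c (-((k + 1 : ℕ) : ℤ))]; congr 1; push_cast; ring
  obtain ⟨k, rfl | rfl⟩ := Int.eq_nat_or_neg lo
  · exact up k
  · exact down k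

/-- **Hole-free column step.** `Qz c = Qz (c−1) + 3·colCharge c`. [folklore] -/
theorem Qz_step (T : ShearedFactor n a s) (h3 : ¬ 3 ∣ n) (c : ℤ) (hc : ∀ j, T.hole c j = false) : T.Qz c = T.Qz (c - 1) + 3 * T.colCharge c := by
  obtain ⟨lo, hb⟩ : ∃ lo : ℤ, T.bdry c lo := by
    rcases T.bdry_zero_or_one c with h | h
    · exact ⟨0, h⟩
    · exact ⟨1, h⟩
  have hb' : T.bdry c (lo + n) := (T.bdry_add_right c lo).2 hb
  have L := T.ladder c n lo hb hb' (fun i _ => hc _)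
  rw [TriangleFactor.rung_period] at L
  have L' := eq_mul_inv_of_mul_eq L
  rw [← T.Q_OutL h3 c lo, ← T.Q_InL h3 c lo, ← T.kc_any c lo, L',
    mul_assoc (st (sV c (lo - 1))) (hol (T.InL c lo n)) (cen _), Q_conj _ (trot_ne_zero h3), Q_mul_cen]

/-- **Hole column step.** If column `c` has a hole (at any height `j₀`), `|Qz c − Qz (c−1) − 3·colCharge c| ≤ 36 + 72n`.
[folklore] -/
theorem Qz_step_hole (T : ShearedFactor n a s) (h3 : ¬ 3 ∣ n) (hn : 1 ≤ n) (c j₀ : ℤ) (hc : T.hole c j₀ = true) :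
    |T.Qz c - T.Qz (c - 1) - 3 * T.colCharge c| ≤ 36 + 72 * n := by
  obtain ⟨m, hm⟩ : ∃ m : ℕ, n = m + 1 := ⟨n - 1, by omega⟩
  have hb0 : T.bdry c j₀ := by
    obtain ⟨hP, -, -, -, -, -, -, -⟩ := six_cases (T.cover c j₀)
    obtain ⟨-, -, hut, hdt, -, -⟩ := hP.1 hc
    exact ⟨hut, hdt⟩
  have hb' : T.bdry c (j₀ + 1 + m) := by
    rw [show j₀ + 1 + (m : ℤ) = j₀ + n by rw [hm]; push_cast; ring]; exact (T.bdry_add_right c j₀).2 hb0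
  have L := T.ladder_hole_run c j₀ m hc hb' (fun i hi => by
    by_contra h
    have h' : T.hole c (j₀ + 1 + i) = true := by simpa using h
    have hd := T.hole_uniq c j₀ (j₀ + 1 + i) hc h'
    rw [show j₀ + 1 + (i : ℤ) - j₀ = 1 + i by ring] at hd
    have := Int.le_of_dvd (by omega) hd
    omega)
  rw [show j₀ + (m : ℤ) = j₀ + n - 1 by rw [hm]; push_cast; ring, TriangleFactor.rung_period, ← hm,
    mul_assoc (st (sV c (j₀ - 1))) (hol (hexLoop c j₀)) (hol (T.InL c j₀ n)),
    mul_assoc (st (sV c (j₀ - 1))) (hol (hexLoop c j₀) * hol (T.InL c j₀ n)) (cen _),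
    mul_assoc (hol (hexLoop c j₀)) (hol (T.InL c j₀ n)) (cen _)] at L
  have L' := eq_mul_inv_of_mul_eq L
  have key : T.Qz c = Q (trot n) (hol (hexLoop c j₀) * (hol (T.InL c j₀ n) * cen (T.kc c j₀ n))) := by
    rw [← T.Q_OutL h3 c j₀, L', Q_conj _ (trot_ne_zero h3)]
  rw [key, ← mul_assoc, Q_mul_cen, Q_mul_left, T.Q_InL h3 c j₀]
  have hC := defect_const_bound c j₀ (trot n)
  have hlen : ((T.InL c j₀ n).length : ℤ) ≤ 4 * n := by
    have := length_lconcat_le (T.inPiece c) j₀ n 4 (T.length_inPiece_le c)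
    rw [InL]; linarith [this]
  have hLin : |dfun (trot n) (hol (hexLoop c j₀)).v (hol (T.InL c j₀ n)).v| ≤ 18 * (T.InL c j₀ n).length := by
    rw [hol_v_eq_sum (T.InL c j₀ n)]
    refine abs_dfun_sum_le _ _ 18 _ fun x hx => ?_
    obtain ⟨i, -, hi⟩ := mem_lconcat hx
    exact defect_step_bound c j₀ (trot n) x (T.mem_steps6_of_mem_inPiece c (j₀ + i) x hi)
  rw [T.kc_any c j₀]
  have e : ∀ X C D K : ℤ, X + C + D + 3 * K - X - 3 * K = C + D := fun _ _ _ _ => by ring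
  rw [e]
  refine (abs_add_le _ _).trans ?_
  have : |dfun (trot n) (hol (hexLoop c j₀)).v (hol (T.InL c j₀ n)).v| ≤ 72 * n := hLin.trans (by nlinarith)
  unfold dfun at this
  linarith

/-! ## Counting and telescoping -/

/-- [folklore] -/
theorem kc_eq_sum (T : ShearedFactor n a s) (c lo : ℤ) (m : ℕ) : T.kc c lo m = ∑ i ∈ range m, T.charge c (lo + i) := by
  induction m with
  | zero => simp [kc]
  | succ m ih => rw [sum_range_succ, ← ih]; rfl

/-- Number of up-tiles (anchors in the fundamental domain `[0,a) × [0,n)`). [folklore] -/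
def upCount (T : ShearedFactor n a s) : ℤ := ∑ c ∈ range a, ∑ j ∈ range n, if T.up c j then 1 else 0

/-- Number of down-tiles (anchors in the fundamental domain `[0,a) × [0,n)`). [folklore] -/
def dnCount (T : ShearedFactor n a s) : ℤ := ∑ c ∈ range a, ∑ j ∈ range n, if T.dn c j then 1 else 0

/-- The total charge is `18·(#up − #down)`. [folklore] -/
theorem sum_colCharge (T : ShearedFactor n a s) : ∑ c ∈ range a, T.colCharge c = 18 * T.upCount - 18 * T.dnCount := by
  rw [upCount, dnCount, Finset.mul_sum, Finset.mul_sum, ← Finset.sum_sub_distrib]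
  refine Finset.sum_congr rfl fun c _ => ?_
  rw [colCharge, kc_eq_sum, Finset.mul_sum, Finset.mul_sum, ← Finset.sum_sub_distrib]
  refine Finset.sum_congr rfl fun j _ => ?_
  rw [zero_add, charge]
  split_ifs <;> simp

/-- The step of every column `c ∈ [0, a)` is exact except possibly for `c = 0`, where it is off by at most `36 + 72n`.
[folklore] -/
theorem abs_Qz_step_le (T : ShearedFactor n a s) (h3 : ¬ 3 ∣ n) (hn : 1 ≤ n) (c : ℤ) :
    |T.Qz c - T.Qz (c - 1) - 3 * T.colCharge c| ≤ 36 + 72 * n := by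
  by_cases h : ∃ j, T.hole c j = true
  · obtain ⟨j₀, hj₀⟩ := h
    exact T.Qz_step_hole h3 hn c j₀ hj₀
  · push Not at h
    rw [T.Qz_step h3 c (fun j => by simpa using h j)]
    have : (0 : ℤ) ≤ n := by omega
    rw [show T.Qz (c - 1) + 3 * T.colCharge c - T.Qz (c - 1) - 3 * T.colCharge c = 0 by ring, abs_zero]
    linarith

/-- **Theorem B on a sheared torus, kernel.**  In every triangle factor of the punctured sheared torus
`ℤ² / ⟨(a,s), (0,n)⟩` (`ShearedFactor n a s`) with `3 ∤ n` and `1 ≤ a`: `3·|#up − #down| ≤ 4n + 2`, `n` the vertical period.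
[folklore] -/
theorem three_mul_abs_sub_le (T : ShearedFactor n a s) (h3 : ¬ 3 ∣ n) (hn : 1 ≤ n) (ha : 1 ≤ a) : 3 * |T.upCount - T.dnCount| ≤ 4 * n + 2 := by
  -- telescoping
  have tel : ∑ i ∈ range a, (T.Qz ((i + 1 : ℕ) - 1 : ℤ) - T.Qz ((i : ℕ) - 1 : ℤ)) = 0 := by
    rw [Finset.sum_range_sub (fun i : ℕ => T.Qz ((i : ℤ) - 1)) a]
    have := T.Qz_add_left h3 (-1)
    rw [show (-1 : ℤ) + a = (a : ℤ) - 1 by ring] at this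
    push_cast; linarith
  -- per column
  set D : ℤ := T.Qz 0 - T.Qz (0 - 1) - 3 * T.colCharge 0 with hD
  have hDle : |D| ≤ 36 + 72 * n := T.abs_Qz_step_le h3 hn 0
  have per : ∀ i ∈ range a, (T.Qz ((i + 1 : ℕ) - 1 : ℤ) - T.Qz ((i : ℕ) - 1 : ℤ)) =
      3 * T.colCharge i + (if i = 0 then D else 0) := by
    intro i hi
    rw [mem_range] at hi
    rcases Nat.eq_zero_or_pos i with rfl | hpos
    · simp [hD]
    · rw [if_neg hpos.ne']
      have hfree : ∀ j, T.hole i j = false := by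
        intro j
        by_contra h
        have h' : T.hole i j = true := by simpa using h
        have hdvd := T.hole_col i j h'
        have := Int.le_of_dvd (by exact_mod_cast hpos) hdvd
        omega
      have := T.Qz_step h3 i hfree
      rw [show (((i + 1 : ℕ) : ℤ) - 1) = i by push_cast; ring, add_zero, this]; ring
  have hδ : ∑ i ∈ range a, (if i = 0 then D else 0) = D := by
    rw [Finset.sum_eq_single 0 (fun b _ hb => if_neg hb) (fun h => absurd (mem_range.2 (by omega)) h), if_pos rfl]
  rw [Finset.sum_congr rfl per, Finset.sum_add_distrib, ← Finset.mul_sum, hδ, sum_colCharge] at tel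
  -- |3·18·(U − D)| = |D| ≤ 36 + 72 n
  have habs : 54 * |T.upCount - T.dnCount| ≤ 36 + 72 * n := by
    rw [show (54 : ℤ) = |(54 : ℤ)| from (abs_of_nonneg (by norm_num)).symm, ← abs_mul]
    have : 54 * (T.upCount - T.dnCount) = -D := by linarith
    rw [this, abs_neg]; exact hDle
  linarith

end ShearedFactor

end Summit.MatrixMultiplication.OmegaCensus.TriangleTorus
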